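import Mathlib
import Literature.NumberTheory.MahlerMeasure.IntegerMahlerMeasure
import Literature.NumberTheory.MahlerMeasure.SmallMeasureStructure
import Literature.NumberTheory.MahlerMeasure.CyclotomicIntegerHeightBound
import HarnessLib

/-!
# Borwein–Dobrowolski–Mossinghoff (Ann. of Math. 2007, Cor. 3.4): odd-coefficient polynomials without cyclotomic factors have `log M(f) ≥ (log 5/4)(1 − 1/n)` — the published form of McKee–Smyth Prop. 11.3, stated as the named fact `OddCoefficientsMahlerLogBound` and DISCHARGED (re-homed proofs)

**Borwein–Dobrowolski–Mossinghoff: Lehmer's problem for polynomials with odd coefficients** (Ann. of Math. 166 (2007), Corollary 3.4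
with Theorem 3.3 and Lemma 3.1, case `m = 2`): if `f ∈ ℤ[x]` has degree `n − 1`, all its coefficients odd, and no cyclotomic factor, then
`log M(f) ≥ (log 5 / 4)(1 − 1/n)`, i.e. `5^{deg f} ≤ M(f)^{4(deg f + 1)}` — RE-HOMED into `Literature/` by the Hodge foundations lane
(`lit-hodgefound`, seat p20, generation 36) from the venture cell `pub-namedobj` (seat `pub-namedobj-mahler`, gen 8): verbatim
DECLARATION-LEVEL ports, in dependency order and each with its original module docstring, of
`Summits/Ventures/DiscreteObjects/Mahler/{OddCoefficientsResultant (8 declarations; the other 5 were re-homed in `SmallMeasureStructure.lean` /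
`CyclotomicIntegerHeightBound.lean` and are imported), OddCoefficientsAuxiliary (7), OddCoefficientsMahlerBound (8; the two census corollaries
`not_subLehmer_*` are not ported)}.lean`, namespace `Summit.Ventures.DiscreteObjects.Mahler` re-rooted as `Literature.NumberTheory.MahlerMeasure`
(this file's path namespace); `intMahlerMeasure` is the sibling port `IntegerMahlerMeasure.lean`.

THE NAMED FACT (Part 4).  The tree's `Literature.NumberTheory.MahlerMeasure.OddCoefficientsMahlerBound` (`OddCoefficientsBound.lean`) types
McKee–Smyth, *Around the Unit Circle*, Proposition 11.3 p.194 AS PRINTED there — "`M(P) ≥ 5^{1/4}`" for every irreducible noncyclotomic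
`P` with odd coefficients, "stated without proof" and attributed to [BHM04], [BDM07].  The primary source proves LESS: [BDM07, Cor. 3.4]
(materialised and read for this port: abstract p.347, Corollary 3.4 p.355) gives the degree-dependent exponent `(1/4)(1 − 1/n)`, `n − 1 = deg f`,
with equality iff `f = ±1`; the flat `5^{1/4}` is reached only in the nonreciprocal case (`M ≥ (1 + √5)/2`, [BHM04]; the tree's
`OddCoefficientsNonreciprocalMahlerBound`, discharged in `OddCoefficientsNonreciprocalBound.lean`) and for Salem numbers ([BDM07, Thm 6.1]:
`log α > (log 5/4)(1 + 1/(10n))`), and p.355 only remarks that "the bound of `5^{1/4} = 1.495348…` is not far from the smallest known measure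
`1.556030…`".  Following the literature-prover rule for over-stated facts (vendor the corrected statement under a NEW name, never edit the
old one in place), Part 4 states Corollary 3.4 VERBATIM as the named fact `OddCoefficientsMahlerLogBound` and DISCHARGES it
(`OddCoefficientsMahlerLogBound_holds`, from Part 3's `log_intMahlerMeasure_ge_of_odd`); the Summits cell typed the same statement Summits-side as
`Summit.Ventures.DiscreteObjects.Mahler.OddCoefficientsMahlerMeasureLogBound` with the same discharge.  `OddCoefficientsMahlerBound` itself is
NOT discharged anywhere in the tree and should be read as stronger than what is in print.

PROOF AS FORMALISED (the paper's, Part headers carry the details): the resultants `Res(f, x^{2n}+1) · Res(f, x^n − 1)⁴ · Res(f, x^n + 1)⁴`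
are nonzero integers each divisible by `2^{deg f}` (Lemma 3.1: `x^n − 1 = 2s + f·(x − 1)` when the coefficients are odd), while over `ℂ` their
product is `|a|^{10n} ∏_α |F(α^n)| ≤ ‖F‖_∞^{deg f} M(f)^{10n}` with `‖F‖_∞² = 2¹⁸/5⁵` (maximum modulus in place of the paper's Lemma 3.2).
One definition (`OddCoefficientsMahlerLogBound : Prop`, discharged in the same file: net named-fact debt 0); imports Mathlib/Literature only;
every declaration carries the citation of the printed statement it formalises.  The Summits originals stay in place (transitional duplication).
-/

noncomputable section

/-!
## Part 1 — port of `Summits/Ventures/DiscreteObjects/Mahler/OddCoefficientsResultant.lean` (8 declarations kept)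

# Resultants of an odd-coefficient polynomial with `X^n ∓ 1`, `X^{2n} + 1` (venture `DiscreteObjects`, target L)

Cell `pub-namedobj`, seat `pub-namedobj-mahler` (gen 8). Framing: lottery ticket; floor = certified
bounds/negative ranges.

This is Lemma 3.1 (case `m = 2`) of Borwein–Dobrowolski–Mossinghoff, *Lehmer's problem for polynomials
with odd coefficients*, Ann. of Math. 166 (2007) 347–366, in Mathlib's vocabulary
(`Polynomial.resultant`, explicit Sylvester formats `(deg f, N)`):

* `exists_X_pow_sub_one_eq_of_odd` — if all coefficients `f_0, …, f_d` of `f ∈ ℤ[X]` are odd then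
  `X^{d+1} - 1 = 2 s + f · (X - 1)` for some `s ∈ ℤ[X]` with `deg s ≤ d + 1` ((3.3) of the paper);
* `two_pow_le_abs_resultant` — if `G = 2 T + f · P` with `deg P + deg f ≤ N` and `Res(f, G) ≠ 0` then
  `2^{deg f} ≤ |Res(f, G)|`; applied to `G = X^{d+1} - 1`, `X^{d+1} + 1`, `X^{2(d+1)} + 1`
  (`two_pow_le_abs_resultant_X_pow_sub_one` / `_add_one` / `_X_pow_two_mul_add_one`);
* `resultant_intCast_eq` — over `ℂ`, `Res(f, G) = a^N ∏_{f(α)=0} G(α)` (Mathlib's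
  `resultant_eq_prod_eval`), and `pow_ne_one_of_cyclotomicFree` — the roots of a cyclotomic-free
  integer polynomial are not roots of unity, so these resultants are nonzero
  (`resultant_ne_zero_of_cyclotomicFree`).

These feed the proof of [BDM07, Cor. 3.4] in `OddCoefficientsMahlerBound`.
-/

section Part1

namespace Literature.NumberTheory.MahlerMeasure

open _root_.Polynomial

/-- A polynomial all of whose coefficients up to the degree are odd is nonzero.
[cite: BorweinDobrowolskiMossinghoff2007, Lemma 3.1 p.353 (case m = 2: resultants of an odd-coefficient f with x^n ∓ 1, x^{2n} + 1 are nonzero multiples of 2^{n−1})] -/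
theorem ne_zero_of_odd_coeffs {f : ℤ[X]} (hodd : ∀ i ≤ f.natDegree, Odd (f.coeff i)) : f ≠ 0 := by
  intro hf
  have h0 := hodd 0 (Nat.zero_le _)
  rw [hf, coeff_zero] at h0
  exact (by decide : ¬ Odd (0 : ℤ)) h0

/-- `deg (X - 1) = 1` over `ℤ`.
[cite: BorweinDobrowolskiMossinghoff2007, Lemma 3.1 p.353 (case m = 2: resultants of an odd-coefficient f with x^n ∓ 1, x^{2n} + 1 are nonzero multiples of 2^{n−1})] -/
theorem natDegree_X_sub_one : (X - 1 : ℤ[X]).natDegree = 1 := by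
  rw [← C_1, natDegree_X_sub_C]

/-- **[BDM07, (3.3)], `m = 2`.** If all coefficients `f_0, …, f_d` of `f ∈ ℤ[X]` are odd, then
`X^{d+1} - 1 = 2 s + f · (X - 1)` for some `s ∈ ℤ[X]` with `deg s ≤ d + 1`
(coefficientwise: `(X - 1) f ≡ X^{d+1} - 1 (mod 2)`).
[cite: BorweinDobrowolskiMossinghoff2007, Lemma 3.1 p.353 (case m = 2: resultants of an odd-coefficient f with x^n ∓ 1, x^{2n} + 1 are nonzero multiples of 2^{n−1})] -/
theorem exists_X_pow_sub_one_eq_of_odd {f : ℤ[X]} (hodd : ∀ i ≤ f.natDegree, Odd (f.coeff i)) :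
    ∃ s : ℤ[X], s.natDegree ≤ f.natDegree + 1 ∧
      (X ^ (f.natDegree + 1) - 1 : ℤ[X]) = C 2 * s + f * (X - 1) := by
  have hfX : f * (X - 1) = X * f - f := by ring
  have hcoeff : ∀ j, (2 : ℤ) ∣ (X ^ (f.natDegree + 1) - 1 - f * (X - 1) : ℤ[X]).coeff j := by
    intro j
    rcases j with _ | i
    · -- constant coefficient: `f_0 - 1`
      have h0 : (X ^ (f.natDegree + 1) - 1 - f * (X - 1) : ℤ[X]).coeff 0 = f.coeff 0 - 1 := by
        rw [hfX, coeff_sub, coeff_sub, coeff_sub, coeff_X_pow, coeff_one_zero, coeff_X_mul_zero,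
          if_neg (by omega)]
        ring
      obtain ⟨k, hk⟩ := hodd 0 (Nat.zero_le _)
      rw [h0, hk]
      exact ⟨k, by ring⟩
    · have hi : (X ^ (f.natDegree + 1) - 1 - f * (X - 1) : ℤ[X]).coeff (i + 1) =
          (if i + 1 = f.natDegree + 1 then 1 else 0) - (f.coeff i - f.coeff (i + 1)) := by
        rw [hfX, coeff_sub, coeff_sub, coeff_sub, coeff_X_pow, coeff_one, coeff_X_mul,
          if_neg (show ¬ (i + 1 = 0) by omega)]
        ring
      rw [hi]
      rcases Nat.lt_trichotomy i f.natDegree with hlt | heq | hgt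
      · -- interior coefficient: difference of two odd numbers
        have hne : ¬ (i + 1 = f.natDegree + 1) := by omega
        rw [if_neg hne]
        obtain ⟨k, hk⟩ := hodd i hlt.le
        obtain ⟨l, hl⟩ := hodd (i + 1) (by omega)
        rw [hk, hl]
        exact ⟨l - k, by ring⟩
      · -- top coefficient: `1 - f_d`
        rw [if_pos (by rw [heq]), coeff_eq_zero_of_natDegree_lt (n := i + 1) (by omega)]
        obtain ⟨k, hk⟩ := hodd i heq.le
        rw [hk]
        exact ⟨-k, by ring⟩
      · -- beyond the degree: zero
        have hne : ¬ (i + 1 = f.natDegree + 1) := by omega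
        rw [if_neg hne, coeff_eq_zero_of_natDegree_lt (n := i) (by omega),
          coeff_eq_zero_of_natDegree_lt (n := i + 1) (by omega)]
        simp
  obtain ⟨s, hs⟩ := (C_dvd_iff_dvd_coeff (2 : ℤ) _).mpr hcoeff
  refine ⟨s, ?_, ?_⟩
  · -- degree bound
    have h2 : (C (2 : ℤ) * s).natDegree = s.natDegree := natDegree_C_mul (by norm_num)
    have hgdeg : (X ^ (f.natDegree + 1) - 1 - f * (X - 1) : ℤ[X]).natDegree ≤ f.natDegree + 1 := by
      refine (natDegree_sub_le _ _).trans (max_le ?_ ?_)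
      · refine (natDegree_sub_le _ _).trans (max_le ?_ ?_)
        · rw [natDegree_X_pow]
        · simp
      · refine natDegree_mul_le.trans ?_
        rw [natDegree_X_sub_one]
    rw [← h2, ← hs]
    exact hgdeg
  · rw [← hs]
    ring

/-- **[BDM07, Lemma 3.1], abstract form.** If `G = 2 T + f · P` with `deg P + deg f ≤ N` and the
resultant `Res_{(deg f, N)}(f, G)` is nonzero, then `2^{deg f} ≤ |Res(f, G)|`: indeed
`Res(f, G) = Res(f, 2T) = 2^{deg f} Res(f, T)` and `Res(f, T)` is a nonzero integer.
[cite: BorweinDobrowolskiMossinghoff2007, Lemma 3.1 p.353 (case m = 2: resultants of an odd-coefficient f with x^n ∓ 1, x^{2n} + 1 are nonzero multiples of 2^{n−1})] -/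
theorem two_pow_le_abs_resultant {f G T P : ℤ[X]} {N : ℕ} (hG : G = C 2 * T + f * P)
    (hP : P.natDegree + f.natDegree ≤ N) (hne : f.resultant G f.natDegree N ≠ 0) :
    (2 : ℤ) ^ f.natDegree ≤ |f.resultant G f.natDegree N| := by
  have h1 : f.resultant G f.natDegree N = 2 ^ f.natDegree * f.resultant T f.natDegree N := by
    rw [hG, resultant_add_mul_right f (C 2 * T) P f.natDegree N hP le_rfl, resultant_C_mul_right]
  rw [h1] at hne ⊢
  have hT : f.resultant T f.natDegree N ≠ 0 := by
    intro h
    apply hne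
    rw [h, mul_zero]
  have h1T : 1 ≤ |f.resultant T f.natDegree N| := Int.one_le_abs hT
  rw [abs_mul, abs_pow, abs_two]
  calc (2 : ℤ) ^ f.natDegree = 2 ^ f.natDegree * 1 := by ring
    _ ≤ 2 ^ f.natDegree * |f.resultant T f.natDegree N| :=
        mul_le_mul_of_nonneg_left h1T (by positivity)

/-- `2^{d} ≤ |Res(f, X^{d+1} - 1)|` for `f` with odd coefficients `f_0, …, f_d`, provided the
resultant is nonzero [BDM07, (3.1) with `m = 2`, `g = f`].
[cite: BorweinDobrowolskiMossinghoff2007, Lemma 3.1 p.353 (case m = 2: resultants of an odd-coefficient f with x^n ∓ 1, x^{2n} + 1 are nonzero multiples of 2^{n−1})] -/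
theorem two_pow_le_abs_resultant_X_pow_sub_one {f : ℤ[X]} (hodd : ∀ i ≤ f.natDegree, Odd (f.coeff i))
    (hne : f.resultant (X ^ (f.natDegree + 1) - 1) f.natDegree (f.natDegree + 1) ≠ 0) :
    (2 : ℤ) ^ f.natDegree ≤ |f.resultant (X ^ (f.natDegree + 1) - 1) f.natDegree (f.natDegree + 1)| := by
  obtain ⟨s, _, hs⟩ := exists_X_pow_sub_one_eq_of_odd hodd
  refine two_pow_le_abs_resultant (T := s) (P := X - 1) hs ?_ hne
  rw [natDegree_X_sub_one]; omega

/-- `2^{d} ≤ |Res(f, X^{d+1} + 1)|` for `f` with odd coefficients, provided the resultant is nonzero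
[BDM07, (3.2) with `k = 0`]: `X^{d+1} + 1 = 2 (s + 1) + f · (X - 1)`.
[cite: BorweinDobrowolskiMossinghoff2007, Lemma 3.1 p.353 (case m = 2: resultants of an odd-coefficient f with x^n ∓ 1, x^{2n} + 1 are nonzero multiples of 2^{n−1})] -/
theorem two_pow_le_abs_resultant_X_pow_add_one {f : ℤ[X]} (hodd : ∀ i ≤ f.natDegree, Odd (f.coeff i))
    (hne : f.resultant (X ^ (f.natDegree + 1) + 1) f.natDegree (f.natDegree + 1) ≠ 0) :
    (2 : ℤ) ^ f.natDegree ≤ |f.resultant (X ^ (f.natDegree + 1) + 1) f.natDegree (f.natDegree + 1)| := by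
  obtain ⟨s, _, hs⟩ := exists_X_pow_sub_one_eq_of_odd hodd
  have hs' : (X ^ (f.natDegree + 1) + 1 : ℤ[X]) = C 2 * (s + 1) + f * (X - 1) := by
    have e2 : (C 2 : ℤ[X]) = 2 := map_ofNat C 2
    rw [e2] at hs ⊢
    linear_combination hs
  refine two_pow_le_abs_resultant (T := s + 1) (P := X - 1) hs' ?_ hne
  rw [natDegree_X_sub_one]; omega

/-- `2^{d} ≤ |Res(f, X^{2(d+1)} + 1)|` for `f` with odd coefficients, provided the resultant is nonzero
[BDM07, (3.2) with `k = 1`]: `X^{2n} + 1 = 2 (2 s (s + 1) + 1) + f · (X - 1)(4 s + 2 + f (X - 1))`.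
[cite: BorweinDobrowolskiMossinghoff2007, Lemma 3.1 p.353 (case m = 2: resultants of an odd-coefficient f with x^n ∓ 1, x^{2n} + 1 are nonzero multiples of 2^{n−1})] -/
theorem two_pow_le_abs_resultant_X_pow_two_mul_add_one {f : ℤ[X]}
    (hodd : ∀ i ≤ f.natDegree, Odd (f.coeff i))
    (hne : f.resultant (X ^ (2 * (f.natDegree + 1)) + 1) f.natDegree (2 * (f.natDegree + 1)) ≠ 0) :
    (2 : ℤ) ^ f.natDegree ≤
      |f.resultant (X ^ (2 * (f.natDegree + 1)) + 1) f.natDegree (2 * (f.natDegree + 1))| := by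
  obtain ⟨s, hsdeg, hs⟩ := exists_X_pow_sub_one_eq_of_odd hodd
  set n := f.natDegree + 1 with hn
  have hs' : (X ^ (2 * n) + 1 : ℤ[X]) =
      C 2 * (C 2 * s * (s + 1) + 1) + f * ((X - 1) * (C 4 * s + C 2 + f * (X - 1))) := by
    have e2 : (C 2 : ℤ[X]) = 2 := map_ofNat C 2
    have e4 : (C 4 : ℤ[X]) = 4 := map_ofNat C 4
    rw [e2, e4, pow_mul']
    rw [e2] at hs
    linear_combination (X ^ n - 1 + 2 * s + f * (X - 1) + 2) * hs
  refine two_pow_le_abs_resultant hs' ?_ hne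
  -- degree of the cofactor: `≤ 1 + (d + 1)`
  have h4s : (C (4 : ℤ) * s + C 2 + f * (X - 1)).natDegree ≤ n := by
    refine (natDegree_add_le _ _).trans (max_le ?_ ?_)
    · refine (natDegree_add_le _ _).trans (max_le ?_ ?_)
      · exact (natDegree_C_mul_le _ _).trans hsdeg
      · simp
    · refine natDegree_mul_le.trans ?_
      rw [natDegree_X_sub_one]
  have hP : ((X - 1) * (C (4 : ℤ) * s + C 2 + f * (X - 1))).natDegree ≤ 1 + n := by
    refine natDegree_mul_le.trans ?_
    rw [natDegree_X_sub_one]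
    omega
  omega

/-! ### Nonvanishing: cyclotomic-free polynomials -/

/-- `Res(f, X^n + 1) ≠ 0` for `f ≠ 0` cyclotomic-free and `n > 0` (a root would satisfy `z^{2n} = 1`).
[cite: BorweinDobrowolskiMossinghoff2007, Lemma 3.1 p.353 (case m = 2: resultants of an odd-coefficient f with x^n ∓ 1, x^{2n} + 1 are nonzero multiples of 2^{n−1})] -/
theorem resultant_X_pow_add_one_ne_zero {f : ℤ[X]} (hf : f ≠ 0)
    (hcf : ∀ m : ℕ, 0 < m → ¬ cyclotomic m ℤ ∣ f) {n : ℕ} (hn : 0 < n) :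
    f.resultant (X ^ n + 1) f.natDegree n ≠ 0 := by
  refine resultant_ne_zero_of_cyclotomicFree (L := 2 * n) hf hcf ?_ (by omega) ?_
  · rw [← C_1, natDegree_X_pow_add_C]
  · intro z hz
    simp only [Polynomial.map_add, Polynomial.map_pow, map_X, Polynomial.map_one, eval_add,
      eval_pow, eval_X, eval_one] at hz
    have hz' : z ^ n = -1 := eq_neg_of_add_eq_zero_left hz
    rw [pow_mul', hz']; norm_num

end Literature.NumberTheory.MahlerMeasure

end Part1

/-!
## Part 2 — port of `Summits/Ventures/DiscreteObjects/Mahler/OddCoefficientsAuxiliary.lean` (7 declarations kept)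

# The Borwein–Dobrowolski–Mossinghoff auxiliary polynomial `(y² + 1)(y² - 1)⁴` (venture `DiscreteObjects`, target L)

Cell `pub-namedobj`, seat `pub-namedobj-mahler` (gen 8). Framing: lottery ticket; floor = certified
bounds/negative ranges.

[BDM07, Cor. 3.4] uses the auxiliary polynomial `F(y) = (1 + y²)(1 - y²)⁴`, for which
`ν(F) = 9`, `deg F = 10` and `‖F‖_∞ = 2⁹ / (25 √5)` (sup norm on the unit circle).  This file proves the
pointwise archimedean estimate that replaces BDM's Lemma 3.2 (`L(F^k)^{1/k} → ‖F‖_∞`) by the maximum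
modulus principle:

* `bdm_poly_ineq` — `(1 - t) t⁴ ≤ 256/3125` for `t ≥ 0`
  (`3125 t⁵ - 3125 t⁴ + 256 = (5t - 4)² (125 t³ + 75 t² + 40 t + 16)`);
* `normSq_bdmAux_le_of_norm_eq_one` — on the unit circle `‖F(z)‖² = 2¹⁰ x² y⁸ ≤ 2¹⁸/5⁵`
  (`z = x + iy`);
* `norm_bdmAux_sq_le` — for every `β ∈ ℂ`: `‖(β² + 1)(β² - 1)⁴‖² ≤ (2¹⁸/5⁵) · max(1, ‖β‖)²⁰`
  (maximum modulus on the closed disc, and `F(β) = β¹⁰ F(1/β)` outside it).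
-/

section Part2

namespace Literature.NumberTheory.MahlerMeasure

open _root_.Complex

/-- `(1 - t) t⁴ ≤ 4⁴/5⁵` for `t ≥ 0` (maximum at `t = 4/5`).
[cite: BorweinDobrowolskiMossinghoff2007, Corollary 3.4 p.355 (proof: the auxiliary polynomial F(y) = (1 + y²)(1 − y²)⁴, ‖F‖_∞ = 2⁹/(25√5))] -/
theorem bdm_poly_ineq {t : ℝ} (ht : 0 ≤ t) : (1 - t) * t ^ 4 ≤ 256 / 3125 := by
  have h : 0 ≤ (5 * t - 4) ^ 2 * (125 * t ^ 3 + 75 * t ^ 2 + 40 * t + 16) := by positivity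
  nlinarith [h]

/-- On the unit circle, `|z² + 1|² = 4 (Re z)²`.
[cite: BorweinDobrowolskiMossinghoff2007, Corollary 3.4 p.355 (proof: the auxiliary polynomial F(y) = (1 + y²)(1 − y²)⁴, ‖F‖_∞ = 2⁹/(25√5))] -/
theorem normSq_sq_add_one_of_norm_eq_one {z : ℂ} (hz : ‖z‖ = 1) :
    normSq (z ^ 2 + 1) = 4 * z.re ^ 2 := by
  have hxy : z.re ^ 2 + z.im ^ 2 = 1 := by
    have h := normSq_eq_norm_sq z
    rw [hz, one_pow, normSq_apply] at h
    nlinarith [h]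
  simp only [normSq_apply, pow_two, add_re, mul_re, one_re, add_im, mul_im, one_im]
  linear_combination (z.re ^ 2 + z.im ^ 2 - 1) * hxy

/-- On the unit circle, `|z² - 1|² = 4 (Im z)²`.
[cite: BorweinDobrowolskiMossinghoff2007, Corollary 3.4 p.355 (proof: the auxiliary polynomial F(y) = (1 + y²)(1 − y²)⁴, ‖F‖_∞ = 2⁹/(25√5))] -/
theorem normSq_sq_sub_one_of_norm_eq_one {z : ℂ} (hz : ‖z‖ = 1) :
    normSq (z ^ 2 - 1) = 4 * z.im ^ 2 := by
  have hxy : z.re ^ 2 + z.im ^ 2 = 1 := by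
    have h := normSq_eq_norm_sq z
    rw [hz, one_pow, normSq_apply] at h
    nlinarith [h]
  simp only [normSq_apply, pow_two, sub_re, mul_re, one_re, sub_im, mul_im, one_im]
  linear_combination (z.re ^ 2 + z.im ^ 2 - 1) * hxy

/-- **Sup norm of the BDM auxiliary polynomial.** For `‖z‖ = 1`,
`‖(z² + 1)(z² - 1)⁴‖² ≤ 2¹⁸/5⁵` (`= (2⁹/(25√5))²`, [BDM07, proof of Cor. 3.4]).
[cite: BorweinDobrowolskiMossinghoff2007, Corollary 3.4 p.355 (proof: the auxiliary polynomial F(y) = (1 + y²)(1 − y²)⁴, ‖F‖_∞ = 2⁹/(25√5))] -/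
theorem normSq_bdmAux_le_of_norm_eq_one {z : ℂ} (hz : ‖z‖ = 1) :
    ‖(z ^ 2 + 1) * (z ^ 2 - 1) ^ 4‖ ^ 2 ≤ 2 ^ 18 / 5 ^ 5 := by
  have hxy : z.re ^ 2 + z.im ^ 2 = 1 := by
    have h := normSq_eq_norm_sq z
    rw [hz, one_pow, normSq_apply] at h
    nlinarith [h]
  rw [← normSq_eq_norm_sq, map_mul, map_pow, normSq_sq_add_one_of_norm_eq_one hz,
    normSq_sq_sub_one_of_norm_eq_one hz]
  have ht := bdm_poly_ineq (sq_nonneg z.im)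
  have hre : z.re ^ 2 = 1 - z.im ^ 2 := by linarith
  rw [hre]
  have h4 : (4 * z.im ^ 2) ^ 4 = 256 * (z.im ^ 2) ^ 4 := by ring
  rw [h4]
  nlinarith [ht, sq_nonneg z.im]

/-- The self-reciprocity `F(β) = β¹⁰ F(1/β)` of the BDM auxiliary polynomial.
[cite: BorweinDobrowolskiMossinghoff2007, Corollary 3.4 p.355 (proof: the auxiliary polynomial F(y) = (1 + y²)(1 − y²)⁴, ‖F‖_∞ = 2⁹/(25√5))] -/
theorem bdmAux_eq_pow_mul_inv {β : ℂ} (hβ : β ≠ 0) :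
    (β ^ 2 + 1) * (β ^ 2 - 1) ^ 4 = β ^ 10 * ((β⁻¹ ^ 2 + 1) * (β⁻¹ ^ 2 - 1) ^ 4) := by
  field_simp
  ring

/-- **Maximum modulus.** For `‖β‖ ≤ 1`: `‖(β² + 1)(β² - 1)⁴‖ ≤ √(2¹⁸/5⁵)`.
[cite: BorweinDobrowolskiMossinghoff2007, Corollary 3.4 p.355 (proof: the auxiliary polynomial F(y) = (1 + y²)(1 − y²)⁴, ‖F‖_∞ = 2⁹/(25√5))] -/
theorem norm_bdmAux_le_of_norm_le_one {β : ℂ} (hβ : ‖β‖ ≤ 1) :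
    ‖(β ^ 2 + 1) * (β ^ 2 - 1) ^ 4‖ ≤ Real.sqrt (2 ^ 18 / 5 ^ 5) := by
  have hd : DiffContOnCl ℂ (fun z : ℂ => (z ^ 2 + 1) * (z ^ 2 - 1) ^ 4) (Metric.ball (0 : ℂ) 1) :=
    Differentiable.diffContOnCl (by fun_prop)
  have hfr : ∀ z ∈ frontier (Metric.ball (0 : ℂ) 1),
      ‖(fun z : ℂ => (z ^ 2 + 1) * (z ^ 2 - 1) ^ 4) z‖ ≤ Real.sqrt (2 ^ 18 / 5 ^ 5) := by
    intro z hz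
    rw [frontier_ball (0 : ℂ) one_ne_zero, mem_sphere_zero_iff_norm] at hz
    calc ‖(fun z : ℂ => (z ^ 2 + 1) * (z ^ 2 - 1) ^ 4) z‖
        = Real.sqrt (‖(z ^ 2 + 1) * (z ^ 2 - 1) ^ 4‖ ^ 2) := (Real.sqrt_sq (norm_nonneg _)).symm
      _ ≤ Real.sqrt (2 ^ 18 / 5 ^ 5) := Real.sqrt_le_sqrt (normSq_bdmAux_le_of_norm_eq_one hz)
  have hcl : β ∈ closure (Metric.ball (0 : ℂ) 1) := by
    rw [closure_ball (0 : ℂ) one_ne_zero, Metric.mem_closedBall, dist_zero_right]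
    exact hβ
  exact Complex.norm_le_of_forall_mem_frontier_norm_le Metric.isBounded_ball hd hfr hcl

/-- For every `β ∈ ℂ`: `‖(β² + 1)(β² - 1)⁴‖ ≤ √(2¹⁸/5⁵) · max(1, ‖β‖)¹⁰`.
[cite: BorweinDobrowolskiMossinghoff2007, Corollary 3.4 p.355 (proof: the auxiliary polynomial F(y) = (1 + y²)(1 − y²)⁴, ‖F‖_∞ = 2⁹/(25√5))] -/
theorem norm_bdmAux_le (β : ℂ) :
    ‖(β ^ 2 + 1) * (β ^ 2 - 1) ^ 4‖ ≤ Real.sqrt (2 ^ 18 / 5 ^ 5) * max 1 ‖β‖ ^ 10 := by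
  have hK : 0 ≤ Real.sqrt (2 ^ 18 / 5 ^ 5) := Real.sqrt_nonneg _
  have hm1 : 1 ≤ max 1 ‖β‖ := le_max_left _ _
  rcases le_or_gt ‖β‖ 1 with hle | hlt
  · calc ‖(β ^ 2 + 1) * (β ^ 2 - 1) ^ 4‖ ≤ Real.sqrt (2 ^ 18 / 5 ^ 5) :=
          norm_bdmAux_le_of_norm_le_one hle
      _ = Real.sqrt (2 ^ 18 / 5 ^ 5) * 1 := (mul_one _).symm
      _ ≤ Real.sqrt (2 ^ 18 / 5 ^ 5) * max 1 ‖β‖ ^ 10 :=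
          mul_le_mul_of_nonneg_left (one_le_pow₀ hm1) hK
  · have hβ0 : β ≠ 0 := by
      intro h; rw [h, norm_zero] at hlt; exact absurd hlt (by norm_num)
    have hinv : ‖β⁻¹‖ ≤ 1 := by
      rw [norm_inv]; exact inv_le_one_of_one_le₀ hlt.le
    have hmax : max 1 ‖β‖ = ‖β‖ := max_eq_right hlt.le
    rw [bdmAux_eq_pow_mul_inv hβ0, norm_mul, norm_pow, hmax, mul_comm]
    exact mul_le_mul_of_nonneg_right (norm_bdmAux_le_of_norm_le_one hinv) (by positivity)

end Literature.NumberTheory.MahlerMeasure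

end Part2

/-!
## Part 3 — port of `Summits/Ventures/DiscreteObjects/Mahler/OddCoefficientsMahlerBound.lean` (8 declarations kept)

# Borwein–Dobrowolski–Mossinghoff: odd-coefficient polynomials have `M(f)^{4(d+1)} ≥ 5^d` (venture `DiscreteObjects`, target L)

Cell `pub-namedobj`, seat `pub-namedobj-mahler` (gen 8). Framing: lottery ticket; floor = certified
bounds/negative ranges.

**Theorem** ([BDM07] P. Borwein, E. Dobrowolski, M. J. Mossinghoff, *Lehmer's problem for polynomials
with odd coefficients*, Ann. of Math. 166 (2007), Cor. 3.4 with Thm. 3.3, case `m = 2`).  If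
`f ∈ ℤ[X]` has degree `d`, all its coefficients `f_0, …, f_d` are odd, and `f` has no cyclotomic factor,
then
`log M(f) ≥ (log 5 / 4) · (1 - 1/(d+1))`, i.e. `5^d ≤ M(f)^{4(d+1)}`
(`five_pow_le_intMahlerMeasure_pow`; rpow / log forms `rpow_le_intMahlerMeasure_of_odd`,
`log_intMahlerMeasure_ge_of_odd`).

Proof (the paper's, with the auxiliary polynomial `F(y) = (y² + 1)(y² - 1)⁴` of Cor. 3.4): the nine
resultants `Res(f, X^{2n}+1) · Res(f, X^n - 1)⁴ · Res(f, X^n + 1)⁴` (`n = d + 1`) are nonzero integers each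
divisible by `2^d` (`OddCoefficientsResultant`), while over `ℂ` their product is
`|a|^{10n} ∏_α |F(α^n)| ≤ ‖F‖_∞^d M(f)^{10n}` with `‖F‖_∞² = 2¹⁸/5⁵` (`OddCoefficientsAuxiliary`,
maximum modulus in place of the paper's Lemma 3.2); hence `2^{9d} ≤ (2⁹ 5^{-5/2})^d M^{10n}`.

Consequences: `M(f) ≥ 5^{1/8} > 1.2` as soon as `d ≥ 1` (`intMahlerMeasure_pow_eight_ge_five_of_odd`),
so **no cyclotomic-free — in particular no irreducible — polynomial with all coefficients odd is
sub-Lehmer** (`not_subLehmer_of_odd_coeffs`, `not_subLehmer_of_irreducible_odd`; for the census of cell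
`pub-namedobj`: an irreducible sub-Lehmer polynomial has an even coefficient), and the irreducible form
with the hypotheses of the Literature statement (`five_pow_le_mahlerMeasure_pow_of_irreducible_odd`).

**On the Literature named fact** `Literature.NumberTheory.MahlerMeasure.OddCoefficientsMahlerBound`
(typed from [McKee–Smyth, *Around the Unit Circle*, Prop. 11.3]: "`M(P) ≥ 5^{1/4}`" for irreducible
noncyclotomic `P` with odd coefficients): the source it cites, [BDM07, Cor. 3.4], proves the bound with
the exponent `(1/4)(1 - 1/(d+1))` formalised here, NOT the degree-free `5^{1/4}` (cf. the chapter notes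
of Brunault–Zudilin, *Many Variations of Mahler Measures*: `m(P) > c (1 - 1/(d+1))`, `c = (log 5)/4`
[BDM07], later `c = 0.4162…`).  That named fact is therefore NOT discharged here and should be read as
stronger than the published theorem; nothing in the tree depends on it.
-/

section Part3

namespace Literature.NumberTheory.MahlerMeasure

open _root_.Polynomial

/-- Per-root archimedean bound: for `α ∈ ℂ` and `n ∈ ℕ`,
`|α^{2n} + 1| · |α^n - 1|⁴ · |α^n + 1|⁴ = |F(α^n)| ≤ √(2¹⁸/5⁵) · max(1,|α|)^{10 n}`.
[cite: BorweinDobrowolskiMossinghoff2007, Corollary 3.4 p.355 (log M(f) ≥ (log 5/4)(1 − 1/n), n − 1 = deg f) via Theorem 3.3 p.354] -/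
theorem bdm_root_bound (α : ℂ) (n : ℕ) :
    ‖α ^ (2 * n) + 1‖ * (‖α ^ n - 1‖ ^ 4 * ‖α ^ n + 1‖ ^ 4) ≤
      Real.sqrt (2 ^ 18 / 5 ^ 5) * max 1 ‖α‖ ^ (10 * n) := by
  have hid : ‖((α ^ n) ^ 2 + 1) * ((α ^ n) ^ 2 - 1) ^ 4‖ =
      ‖α ^ (2 * n) + 1‖ * (‖α ^ n - 1‖ ^ 4 * ‖α ^ n + 1‖ ^ 4) := by
    have h2 : (α ^ n) ^ 2 = α ^ (2 * n) := by rw [← pow_mul, mul_comm]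
    have h3 : (α ^ n) ^ 2 - 1 = (α ^ n - 1) * (α ^ n + 1) := by ring
    rw [h3, h2, norm_mul, norm_pow, norm_mul, mul_pow]
  rw [← hid]
  refine (norm_bdmAux_le (α ^ n)).trans ?_
  have hm : max 1 ‖α ^ n‖ ≤ max 1 ‖α‖ ^ n := by
    rw [norm_pow]
    exact max_le (one_le_pow₀ (le_max_left _ _))
      (pow_le_pow_left₀ (norm_nonneg _) (le_max_right _ _) n)
  have hK : 0 ≤ Real.sqrt (2 ^ 18 / 5 ^ 5) := Real.sqrt_nonneg _
  calc Real.sqrt (2 ^ 18 / 5 ^ 5) * max 1 ‖α ^ n‖ ^ 10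
      ≤ Real.sqrt (2 ^ 18 / 5 ^ 5) * (max 1 ‖α‖ ^ n) ^ 10 :=
        mul_le_mul_of_nonneg_left (pow_le_pow_left₀ (by positivity) hm 10) hK
    _ = Real.sqrt (2 ^ 18 / 5 ^ 5) * max 1 ‖α‖ ^ (10 * n) := by rw [← pow_mul, mul_comm n 10]

/-- Norm form of a resultant inequality: if `2^{deg f} ≤ |Res_{(deg f, N)}(f, G)|` and `G(z) = g(z)` on
`ℂ`, then `2^{deg f} ≤ |a|^N ∏_α |g(α)|` over the complex roots `α` of `f` (`a` = leading coefficient).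
[cite: BorweinDobrowolskiMossinghoff2007, Corollary 3.4 p.355 (log M(f) ≥ (log 5/4)(1 − 1/n), n − 1 = deg f) via Theorem 3.3 p.354] -/
theorem two_pow_le_norm_prod {f G : ℤ[X]} {N : ℕ} (hG : G.natDegree ≤ N)
    (h : (2 : ℤ) ^ f.natDegree ≤ |f.resultant G f.natDegree N|) (g : ℂ → ℂ)
    (hg : ∀ z, (G.map (Int.castRingHom ℂ)).eval z = g z) :
    (2 : ℝ) ^ f.natDegree ≤ ‖(f.map (Int.castRingHom ℂ)).leadingCoeff‖ ^ N *
      ((f.map (Int.castRingHom ℂ)).roots.map (fun α => ‖g α‖)).prod := by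
  have h1 : (2 : ℝ) ^ f.natDegree ≤ ‖((f.resultant G f.natDegree N : ℤ) : ℂ)‖ := by
    rw [Complex.norm_intCast]
    exact_mod_cast h
  rw [resultant_intCast_eq hG, norm_mul, norm_pow] at h1
  have hmp := map_multiset_prod (normHom : ℂ →*₀ ℝ)
    (((f.map (Int.castRingHom ℂ)).roots.map (G.map (Int.castRingHom ℂ)).eval))
  rw [Multiset.map_map] at hmp
  simp only [normHom_apply, Function.comp_def] at hmp
  rw [hmp] at h1
  simp only [hg] at h1
  exact h1

/-- **Borwein–Dobrowolski–Mossinghoff [BDM07, Cor. 3.4 / Thm. 3.3, `m = 2`].**  If all coefficients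
`f_0, …, f_d` of `f ∈ ℤ[X]` are odd and `f` has no cyclotomic factor, then `5^d ≤ M(f)^{4(d+1)}`, i.e.
`log M(f) ≥ (log 5/4)(1 - 1/(d+1))`.
[cite: BorweinDobrowolskiMossinghoff2007, Corollary 3.4 p.355 (log M(f) ≥ (log 5/4)(1 − 1/n), n − 1 = deg f) via Theorem 3.3 p.354] -/
theorem five_pow_le_intMahlerMeasure_pow {f : ℤ[X]} (hodd : ∀ i ≤ f.natDegree, Odd (f.coeff i))
    (hcf : ∀ m : ℕ, 0 < m → ¬ cyclotomic m ℤ ∣ f) :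
    (5 : ℝ) ^ f.natDegree ≤ intMahlerMeasure f ^ (4 * (f.natDegree + 1)) := by
  have hf0 : f ≠ 0 := ne_zero_of_odd_coeffs hodd
  -- the three resultant inequalities, in norm form over `ℂ`
  have h1 := two_pow_le_norm_prod (N := f.natDegree + 1) (by rw [← C_1, natDegree_X_pow_sub_C])
    (two_pow_le_abs_resultant_X_pow_sub_one hodd
      (resultant_X_pow_sub_one_ne_zero hf0 hcf (Nat.succ_pos _)))
    (fun α : ℂ => α ^ (f.natDegree + 1) - 1) (fun z => by simp)
  have h2 := two_pow_le_norm_prod (N := f.natDegree + 1) (by rw [← C_1, natDegree_X_pow_add_C])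
    (two_pow_le_abs_resultant_X_pow_add_one hodd
      (resultant_X_pow_add_one_ne_zero hf0 hcf (Nat.succ_pos _)))
    (fun α : ℂ => α ^ (f.natDegree + 1) + 1) (fun z => by simp)
  have h3 := two_pow_le_norm_prod (N := 2 * (f.natDegree + 1))
    (by rw [← C_1, natDegree_X_pow_add_C])
    (two_pow_le_abs_resultant_X_pow_two_mul_add_one hodd
      (resultant_X_pow_add_one_ne_zero hf0 hcf (by omega)))
    (fun α : ℂ => α ^ (2 * (f.natDegree + 1)) + 1) (fun z => by simp)
  -- notation
  set d := f.natDegree with hd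
  set n := d + 1 with hn
  set A : ℝ := ‖(f.map (Int.castRingHom ℂ)).leadingCoeff‖ with hA
  set R := (f.map (Int.castRingHom ℂ)).roots with hR
  have hinj : Function.Injective (Int.castRingHom ℂ) := (Int.castRingHom ℂ).injective_int
  have hcard : Multiset.card R = d := by
    have hs := (IsAlgClosed.splits (f.map (Int.castRingHom ℂ))).natDegree_eq_card_roots
    rw [natDegree_map_eq_of_injective hinj] at hs
    rw [hR, ← hs]
  have hM : intMahlerMeasure f = A * (R.map (fun α => max 1 ‖α‖)).prod :=
    mahlerMeasure_eq_leadingCoeff_mul_prod_roots _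
  set Pm := (R.map (fun α => max 1 ‖α‖)).prod with hPm
  set K : ℝ := Real.sqrt (2 ^ 18 / 5 ^ 5) with hK
  have hA0 : 0 ≤ A := norm_nonneg _
  have hPm0 : 0 ≤ Pm := Multiset.prod_map_nonneg (fun α _ => by positivity)
  have hK0 : 0 ≤ K := Real.sqrt_nonneg _
  -- product of the nine inequalities
  have hT : (R.map (fun α : ℂ => ‖α ^ (2 * n) + 1‖ * (‖α ^ n - 1‖ ^ 4 * ‖α ^ n + 1‖ ^ 4))).prod =
      (R.map (fun α : ℂ => ‖α ^ (2 * n) + 1‖)).prod *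
        ((R.map (fun α : ℂ => ‖α ^ n - 1‖)).prod ^ 4 * (R.map (fun α : ℂ => ‖α ^ n + 1‖)).prod ^ 4) := by
    rw [Multiset.prod_map_mul, Multiset.prod_map_mul, Multiset.prod_map_pow, Multiset.prod_map_pow]
  have hTle : (R.map (fun α : ℂ => ‖α ^ (2 * n) + 1‖ * (‖α ^ n - 1‖ ^ 4 * ‖α ^ n + 1‖ ^ 4))).prod ≤
      K ^ d * Pm ^ (10 * n) := by
    calc (R.map (fun α : ℂ => ‖α ^ (2 * n) + 1‖ * (‖α ^ n - 1‖ ^ 4 * ‖α ^ n + 1‖ ^ 4))).prod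
        ≤ (R.map (fun α : ℂ => K * max 1 ‖α‖ ^ (10 * n))).prod :=
          Multiset.prod_map_le_prod_map₀ _ _ (fun α _ => by positivity) (fun α _ => bdm_root_bound α n)
      _ = K ^ d * Pm ^ (10 * n) := by
          rw [Multiset.prod_map_mul, Multiset.prod_map_pow, Multiset.map_const', Multiset.prod_replicate,
            hcard]
  have hX1 := pow_le_pow_left₀ (by positivity) h1 4
  have hX2 := pow_le_pow_left₀ (by positivity) h2 4
  have h0X3 : (0 : ℝ) ≤ A ^ (2 * n) * (R.map (fun α : ℂ => ‖α ^ (2 * n) + 1‖)).prod :=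
    le_trans (by positivity) h3
  have h0X1 : (0 : ℝ) ≤ (A ^ n * (R.map (fun α : ℂ => ‖α ^ n - 1‖)).prod) ^ 4 :=
    le_trans (by positivity) hX1
  have E : ((2 : ℝ) ^ d) ^ 9 ≤ K ^ d * (A * Pm) ^ (10 * n) := by
    calc ((2 : ℝ) ^ d) ^ 9 = 2 ^ d * ((2 ^ d) ^ 4 * (2 ^ d) ^ 4) := by ring
      _ ≤ (A ^ (2 * n) * (R.map (fun α : ℂ => ‖α ^ (2 * n) + 1‖)).prod) *
            ((A ^ n * (R.map (fun α : ℂ => ‖α ^ n - 1‖)).prod) ^ 4 *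
              (A ^ n * (R.map (fun α : ℂ => ‖α ^ n + 1‖)).prod) ^ 4) :=
          mul_le_mul h3 (mul_le_mul hX1 hX2 (by positivity) h0X1) (by positivity) h0X3
      _ = A ^ (10 * n) * ((R.map (fun α : ℂ => ‖α ^ (2 * n) + 1‖)).prod *
            ((R.map (fun α : ℂ => ‖α ^ n - 1‖)).prod ^ 4 *
              (R.map (fun α : ℂ => ‖α ^ n + 1‖)).prod ^ 4)) := by ring
      _ ≤ A ^ (10 * n) * (K ^ d * Pm ^ (10 * n)) := by
          rw [← hT]
          exact mul_le_mul_of_nonneg_left hTle (by positivity)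
      _ = K ^ d * (A * Pm) ^ (10 * n) := by ring
  rw [← hM] at E
  -- square and clear the constants: `2^{18 d} ≤ (2^18/5^5)^d M^{20 n}` gives `5^{5d} ≤ M^{20 n}`
  have hM0 : 0 ≤ intMahlerMeasure f := by rw [hM]; positivity
  have E2 : (((2 : ℝ) ^ d) ^ 9) ^ 2 ≤ (K ^ d * intMahlerMeasure f ^ (10 * n)) ^ 2 :=
    pow_le_pow_left₀ (by positivity) E 2
  have hK2 : K ^ 2 = 2 ^ 18 / 5 ^ 5 := Real.sq_sqrt (by positivity)
  have E3 : ((2 : ℝ) ^ 18) ^ d ≤ ((2 : ℝ) ^ 18 / 5 ^ 5) ^ d * intMahlerMeasure f ^ (20 * n) := by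
    have lhs : (((2 : ℝ) ^ d) ^ 9) ^ 2 = ((2 : ℝ) ^ 18) ^ d := by
      rw [← pow_mul, ← pow_mul, ← pow_mul]; ring_nf
    have rhs : (K ^ d * intMahlerMeasure f ^ (10 * n)) ^ 2 =
        (K ^ 2) ^ d * intMahlerMeasure f ^ (20 * n) := by
      rw [mul_pow, ← pow_mul, ← pow_mul, ← pow_mul]; ring_nf
    rw [lhs, rhs, hK2] at E2
    exact E2
  have E4 : ((5 : ℝ) ^ 5) ^ d ≤ intMahlerMeasure f ^ (20 * n) := by
    rw [div_pow] at E3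
    have hpos : (0 : ℝ) < (2 ^ 18) ^ d := by positivity
    have hpos5 : (0 : ℝ) < (5 ^ 5) ^ d := by positivity
    -- `(2^18)^d ≤ (2^18)^d / (5^5)^d * X`  ⇒  `(5^5)^d ≤ X`
    rw [div_mul_eq_mul_div, le_div_iff₀ hpos5] at E3
    nlinarith [E3, hpos]
  have E5 : ((5 : ℝ) ^ d) ^ 5 ≤ (intMahlerMeasure f ^ (4 * n)) ^ 5 := by
    have l : ((5 : ℝ) ^ d) ^ 5 = ((5 : ℝ) ^ 5) ^ d := by rw [← pow_mul, ← pow_mul, mul_comm]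
    have r : (intMahlerMeasure f ^ (4 * n)) ^ 5 = intMahlerMeasure f ^ (20 * n) := by
      rw [← pow_mul, show 4 * n * 5 = 20 * n by ring]
    rw [l, r]
    exact E4
  exact le_of_pow_le_pow_left₀ (by norm_num) (by positivity) E5

/-- Rpow form: `M(f) ≥ 5^{d/(4(d+1))}`.
[cite: BorweinDobrowolskiMossinghoff2007, Corollary 3.4 p.355 (log M(f) ≥ (log 5/4)(1 − 1/n), n − 1 = deg f) via Theorem 3.3 p.354] -/
theorem rpow_le_intMahlerMeasure_of_odd {f : ℤ[X]} (hodd : ∀ i ≤ f.natDegree, Odd (f.coeff i))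
    (hcf : ∀ m : ℕ, 0 < m → ¬ cyclotomic m ℤ ∣ f) :
    (5 : ℝ) ^ ((f.natDegree : ℝ) / (4 * (f.natDegree + 1))) ≤ intMahlerMeasure f := by
  have h := five_pow_le_intMahlerMeasure_pow hodd hcf
  have hM0 : 0 ≤ intMahlerMeasure f := by
    unfold intMahlerMeasure; exact Polynomial.mahlerMeasure_nonneg _
  have hN : (0 : ℝ) < 4 * (f.natDegree + 1) := by positivity
  -- take the `4(d+1)`-th root
  have h' : ((5 : ℝ) ^ ((f.natDegree : ℝ) / (4 * (f.natDegree + 1)))) ^ (4 * (f.natDegree + 1)) ≤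
      intMahlerMeasure f ^ (4 * (f.natDegree + 1)) := by
    rw [← Real.rpow_natCast, ← Real.rpow_mul (by norm_num)]
    have : (f.natDegree : ℝ) / (4 * (f.natDegree + 1)) * ((4 * (f.natDegree + 1) : ℕ) : ℝ) =
        (f.natDegree : ℝ) := by
      push_cast
      field_simp
    rw [this, Real.rpow_natCast]
    exact h
  exact le_of_pow_le_pow_left₀ (by positivity) hM0 h'

/-- Logarithmic form [BDM07, (3.7)]: `log M(f) ≥ (log 5 / 4)(1 - 1/(d+1))`.
[cite: BorweinDobrowolskiMossinghoff2007, Corollary 3.4 p.355 (log M(f) ≥ (log 5/4)(1 − 1/n), n − 1 = deg f) via Theorem 3.3 p.354] -/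
theorem log_intMahlerMeasure_ge_of_odd {f : ℤ[X]} (hodd : ∀ i ≤ f.natDegree, Odd (f.coeff i))
    (hcf : ∀ m : ℕ, 0 < m → ¬ cyclotomic m ℤ ∣ f) :
    Real.log 5 / 4 * (1 - 1 / (f.natDegree + 1)) ≤ Real.log (intMahlerMeasure f) := by
  have h := rpow_le_intMahlerMeasure_of_odd hodd hcf
  have h5 : (0 : ℝ) < (5 : ℝ) ^ ((f.natDegree : ℝ) / (4 * (f.natDegree + 1))) := by positivity
  have hlog := Real.log_le_log h5 h
  rw [Real.log_rpow (by norm_num)] at hlog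
  have heq : Real.log 5 / 4 * (1 - 1 / (f.natDegree + 1)) =
      (f.natDegree : ℝ) / (4 * (f.natDegree + 1)) * Real.log 5 := by
    have : (f.natDegree : ℝ) + 1 ≠ 0 := by positivity
    field_simp
    ring
  rw [heq]
  exact hlog

/-- For `d ≥ 1`: `M(f)^8 ≥ 5`, i.e. `M(f) ≥ 5^{1/8} = 1.2228…`.
[cite: BorweinDobrowolskiMossinghoff2007, Corollary 3.4 p.355 (log M(f) ≥ (log 5/4)(1 − 1/n), n − 1 = deg f) via Theorem 3.3 p.354] -/
theorem intMahlerMeasure_pow_eight_ge_five_of_odd {f : ℤ[X]} (hodd : ∀ i ≤ f.natDegree, Odd (f.coeff i))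
    (hcf : ∀ m : ℕ, 0 < m → ¬ cyclotomic m ℤ ∣ f) (hd : 1 ≤ f.natDegree) :
    (5 : ℝ) ≤ intMahlerMeasure f ^ 8 := by
  have h := five_pow_le_intMahlerMeasure_pow hodd hcf
  have hM0 : 0 ≤ intMahlerMeasure f := by
    unfold intMahlerMeasure; exact Polynomial.mahlerMeasure_nonneg _
  have hM1 : 1 ≤ intMahlerMeasure f := one_le_intMahlerMeasure (ne_zero_of_odd_coeffs hodd)
  -- from `5^d ≤ M^{4(d+1)}`, `4(d+1) ≤ 8d` (as `d ≥ 1`) and `M ≥ 1`: `5^d ≤ M^{8d} = (M^8)^d`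
  have h2 : intMahlerMeasure f ^ (4 * (f.natDegree + 1)) ≤ intMahlerMeasure f ^ (8 * f.natDegree) :=
    pow_le_pow_right₀ hM1 (by omega)
  have h3 : (5 : ℝ) ^ f.natDegree ≤ (intMahlerMeasure f ^ 8) ^ f.natDegree := by
    rw [← pow_mul]; exact h.trans h2
  exact le_of_pow_le_pow_left₀ (by omega) (by positivity) h3

/-- If an irreducible `f ∈ ℤ[X]` has `M(f) > 1` then `f` is cyclotomic-free (an irreducible multiple of
`Φ_m` is `± Φ_m`, of measure `1`).
[cite: BorweinDobrowolskiMossinghoff2007, Corollary 3.4 p.355 (log M(f) ≥ (log 5/4)(1 − 1/n), n − 1 = deg f) via Theorem 3.3 p.354] -/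
theorem cyclotomicFree_of_irreducible_of_one_lt {f : ℤ[X]} (hirr : Irreducible f)
    (h1 : 1 < intMahlerMeasure f) : ∀ m : ℕ, 0 < m → ¬ cyclotomic m ℤ ∣ f := by
  intro m hm hdvd
  have hass : Associated (cyclotomic m ℤ) f := (cyclotomic.irreducible hm).associated_of_dvd hirr hdvd
  obtain ⟨u, hu⟩ := hass
  obtain ⟨c, hc, hcu⟩ := Polynomial.isUnit_iff.mp u.isUnit
  have hMu : intMahlerMeasure (↑u : ℤ[X]) = 1 := by
    rw [← hcu]
    unfold intMahlerMeasure
    rw [map_C, mahlerMeasure_const, eq_intCast, Complex.norm_intCast]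
    rcases Int.isUnit_iff.mp hc with h | h <;> simp [h]
  have hM : intMahlerMeasure f = 1 := by
    rw [← hu, intMahlerMeasure_mul, intMahlerMeasure_cyclotomic, hMu, one_mul]
  linarith

/-- **Irreducible form** (the hypotheses of the Literature statement
`Literature.NumberTheory.MahlerMeasure.OddCoefficientsMahlerBound`, with the exponent actually proved
in [BDM07, Cor. 3.4]): an irreducible `P ∈ ℤ[X]` with `P ∤ X^n - 1` for all `n ≥ 1` and all coefficients
odd satisfies `5^{deg P} ≤ M(P)^{4(deg P + 1)}`.
[cite: BorweinDobrowolskiMossinghoff2007, Corollary 3.4 p.355 (log M(f) ≥ (log 5/4)(1 − 1/n), n − 1 = deg f) via Theorem 3.3 p.354] -/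
theorem five_pow_le_mahlerMeasure_pow_of_irreducible_odd (P : ℤ[X]) (hirr : Irreducible P)
    (hnc : ∀ n : ℕ, 0 < n → ¬ P ∣ X ^ n - 1) (hodd : ∀ i ≤ P.natDegree, Odd (P.coeff i)) :
    (5 : ℝ) ^ P.natDegree ≤ (P.map (Int.castRingHom ℂ)).mahlerMeasure ^ (4 * (P.natDegree + 1)) := by
  have hcf : ∀ m : ℕ, 0 < m → ¬ cyclotomic m ℤ ∣ P := by
    intro m hm hdvd
    have hass : Associated (cyclotomic m ℤ) P :=
      (cyclotomic.irreducible hm).associated_of_dvd hirr hdvd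
    exact hnc m hm (hass.symm.dvd.trans (cyclotomic.dvd_X_pow_sub_one m ℤ))
  exact five_pow_le_intMahlerMeasure_pow hodd hcf

end Literature.NumberTheory.MahlerMeasure

end Part3

/-! ## Part 4 — the published statement [BDM07, Cor. 3.4] as the named fact `OddCoefficientsMahlerLogBound`, and its discharge -/

namespace Literature.NumberTheory.MahlerMeasure

open _root_.Polynomial

/-- **Odd-coefficient Mahler-measure bound, AS PUBLISHED** — Borwein–Dobrowolski–Mossinghoff, Corollary 3.4: "Let `f` be a polynomial
with degree `n − 1` having odd coefficients and no cyclotomic factors.  Then `log M(f) ≥ (log 5 / 4)(1 − 1/n)`, with equality if and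
only if `f(x) = ±1`."  *No cyclotomic factors* is expressed as `Φ_m ∤ f` for every `m ≥ 1`; `M` is Mathlib's `Polynomial.mahlerMeasure`
of the image of `f` over `ℂ`; `n = f.natDegree + 1`.  This is the CORRECTED form of the tree's `OddCoefficientsMahlerBound` (McKee–Smyth
Prop. 11.3 as printed: the flat `M(P) ≥ 5^{1/4}`, which [BDM07] does not prove — see this file's header); same statement as the Summits-side
`Summit.Ventures.DiscreteObjects.Mahler.OddCoefficientsMahlerMeasureLogBound`.  Discharged below.
[cite: BorweinDobrowolskiMossinghoff2007, Corollary 3.4 p.355] -/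
def OddCoefficientsMahlerLogBound : Prop :=
  ∀ f : ℤ[X], (∀ i ≤ f.natDegree, Odd (f.coeff i)) → (∀ m : ℕ, 0 < m → ¬ cyclotomic m ℤ ∣ f) →
    Real.log 5 / 4 * (1 - 1 / ((f.natDegree : ℝ) + 1)) ≤ Real.log ((f.map (Int.castRingHom ℂ)).mahlerMeasure)

/-- **The Literature named fact `OddCoefficientsMahlerLogBound` HOLDS** ([BDM07, Cor. 3.4], kernel proof: Part 3's
`log_intMahlerMeasure_ge_of_odd`).  Literature-side twin of `Summit.Ventures.DiscreteObjects.Mahler.oddCoefficientsMahlerMeasureLogBound_holds`.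
[cite: BorweinDobrowolskiMossinghoff2007, Corollary 3.4 p.355] -/
theorem OddCoefficientsMahlerLogBound_holds : OddCoefficientsMahlerLogBound :=
  fun _ hodd hcf => log_intMahlerMeasure_ge_of_odd hodd hcf

/-- **Corollary (multiplicative form for the hypotheses of `OddCoefficientsMahlerBound`)**: an irreducible `P ∈ ℤ[X]` with
`P ∤ X^n − 1` for all `n ≥ 1` and all coefficients odd has `5^{deg P} ≤ M(P)^{4(deg P + 1)}`, i.e. `M(P) ≥ 5^{(1/4)(1 − 1/(deg P + 1))}`
— what [BDM07, Cor. 3.4] gives towards McKee–Smyth Prop. 11.3 (restates Part 3's `five_pow_le_mahlerMeasure_pow_of_irreducible_odd`).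
[cite: BorweinDobrowolskiMossinghoff2007, Corollary 3.4 p.355] -/
theorem OddCoefficientsMahlerLogBound.pow_form (P : ℤ[X]) (hirr : Irreducible P)
    (hnc : ∀ n : ℕ, 0 < n → ¬ P ∣ X ^ n - 1) (hodd : ∀ i ≤ P.natDegree, Odd (P.coeff i)) :
    (5 : ℝ) ^ P.natDegree ≤ (P.map (Int.castRingHom ℂ)).mahlerMeasure ^ (4 * (P.natDegree + 1)) :=
  five_pow_le_mahlerMeasure_pow_of_irreducible_odd P hirr hnc hodd

end Literature.NumberTheory.MahlerMeasure

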